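import Mathlib
import HarnessLib
import HarnessLib.Audit
import Summits.ABC.ABC.Statement
import Literature.NumberTheory.DiophantineGeometry.AbcWave0

/-!
Route: InterimWave0

CLOSED (closed) 2026-08-15T12:48:42Z by planner-ABC-route-ABC-InterimWave0-0 — reason: completed-in-literature: not a line of attack (restates the target / consequences of the summit) — note: route-repair rrepair-ABC-InterimWave0-710d7910 (planner, 2026-08-15): CLOSED (closed_as=closed) — not a line of attack on ABC; its provable content is already in Literature. (1) Shape: the 7 carry-over items are 2 RESTATEMENTS of the target (stmt-ABC-0004 ABCQualityForm ↔ ABC; stmt-ABC-0010 NConject. The file is kept as the record of this route; refuted decls are indexed as negative knowledge (`ledger negatives`).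

Carry-over of the interim blast's sorried statements ABOUT ABC from the interim Wave-0 family file
(Statements/Abc/Wave0.lean; harness21 @ d8f2665). Thesis (to be sharpened by the route planner,
D-0014e): the equivalences/implications these 7 statements assert (abcQualityForm_iff_abcConjecture,
abcConjecture_imp_eventually_fermatLastTheoremFor, abcConjecture_imp_infinite_non_wieferich,
abcConjecture_imp_erdosWoods, abcConjecture_imp_hallConjecture,
abcConjecture_imp_fermatCatalanConjecture…) hold and, combined, bear on ABC. They enter as UNSTAMPED
statement items: grounder first (most are cited results -> named facts in Literature), then refuter,
then provers.

Rationale: M5 migration (docs/m5/PLAN.md 2c‴ as amended by D-0014b): no workspace, no THESIS.md; the interim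
decl text is in run/m5/workspaces/ for the operator and quoted in each item's --informal.

History (route lifecycle, newest last):
- 2026-08-15T12:48:43Z · CLOSED closed — completed-in-literature: not a line of attack (restates the target / consequences of the summit) (planner-ABC-route-ABC-InterimWave0-0)

sub-problem: ABC · status: closed(closed) · opened operator:999:2871184 2026-08-13T05:39:09Z · rev 0 · ledger route-ABC-InterimWave0
GENERATED by the gate from the ledger (D-0016/17). Provers cite these decls: `theorem foo : Summit.ABC.ABC.Theses.InterimWave0.<Decl> := …` in Summits/ABC/ABC/Theorems/<Name>.lean.
-/

namespace Summit.ABC.ABC.Theses.InterimWave0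

open scoped BigOperators Topology Manifold Classical MeasureTheory ProbabilityTheory Matrix InnerProductSpace ComplexConjugate ContinuousMap
open Filter Set Function TopologicalSpace MeasureTheory

attribute [summit_statement] _root_.ABC

open Literature.Abc

-- TODO item stmt-ABC-0004 · crux · rank 2 · closed · moot by None · by operator — BLOCKED: missing decl(s) ABCConjecture; restate via `ledger route edit` once they land:
--   def AbcQualityFormIffAbcConjecture : Prop := ABCQualityForm ↔ ABCConjecture

-- TODO item stmt-ABC-0005 · support · rank 3 · closed · moot by None · by operator — BLOCKED: missing decl(s) ABCConjecture; restate via `ledger route edit` once they land: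
--   def AbcConjectureImpEventuallyFermatLastTheoremFor : Prop := ∀ (h : ABCConjecture), ∃ n₀ : ℕ, ∀ n : ℕ, n₀ ≤ n → FermatLastTheoremFor n

-- TODO item stmt-ABC-0006 · support · rank 4 · closed · moot by None · by operator — BLOCKED: missing decl(s) ABCConjecture; restate via `ledger route edit` once they land:
--   def AbcConjectureImpInfiniteNonWieferich : Prop := ∀ (h : ABCConjecture) {a : ℕ} (ha : 2 ≤ a), {p : ℕ | p.Prime ∧ ¬ IsWieferich a p}.Infinite

-- TODO item stmt-ABC-0007 · support · rank 5 · closed · moot by None · by operator — BLOCKED: missing decl(s) ABCConjecture, ABCQualityForm; restate via `ledger route edit` once they land: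
--   def AbcConjectureImpErdosWoods : Prop := ∀ (h : ABCConjecture), ErdosWoodsConjecture

-- TODO item stmt-ABC-0008 · support · rank 6 · closed · moot by None · by operator — BLOCKED: missing decl(s) ABCConjecture; restate via `ledger route edit` once they land:
--   def AbcConjectureImpHallConjecture : Prop := ∀ (h : ABCConjecture), HallConjecture

-- TODO item stmt-ABC-0009 · support · rank 7 · closed · moot by None · by operator — BLOCKED: missing decl(s) ABCConjecture; restate via `ledger route edit` once they land:
--   def AbcConjectureImpFermatCatalanConjecture : Prop := ∀ (h : ABCConjecture), FermatCatalanConjecture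

-- TODO item stmt-ABC-0010 · support · rank 8 · closed · moot by None · by operator — BLOCKED: missing decl(s) ABCConjecture; restate via `ledger route edit` once they land:
--   def NConjectureThreeIffAbcConjecture : Prop := NConjecture 3 ↔ ABCConjecture

end Summit.ABC.ABC.Theses.InterimWave0
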